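import Summits.CriticalPhenomena.CardyFormulaZ2.Theorems.CardyComplexConeEdgePrecompactUFRSTwoArcCore

set_option linter.unusedVariables false

/-!
# Two orbit stretches with different winding contributions: a winding excursion polygon
(line `qkz-strip-boundary-arm` of crux `CardyComplexCone.EdgePrecompact`, stmt-CriticalPhenomena-11387;
fourth file of the planar input `medialTwoArcSurround_ball` of the residual `ufrs_slippedReturnCase_cert(J)`)

Two orbit stretches `O₀ c [0, n₀]` (injective) and `O₁ c [0, n₁]` with the same last corner. An
EXCURSION of the second relative to the first is a pair of consecutive COMMON times `s < t`
(`O₁ c s = O₀ c σ`, `O₁ c t = O₀ c τ`, no `O₁ c j`, `s < j < t`, on the first stretch) other than a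
common step (`t = s + 1 ∧ τ = σ + 1`); its POLYGON is the closed dart chain made of the free darts
`O₁ c (s, t)` (reversed) and the darts of the first stretch between `σ` and `τ` (forward if `σ < τ`,
reversed if `τ ≤ σ`).

* `exists_excursion_of_sum_ne_SR` — WINDING PIGEONHOLE: if per-dart weights of the two stretches that
  agree on common corners have different totals, some excursion has a nonzero weight
  `(∑_{i<τ} - ∑_{i<σ}) a - (∑_{j<t} - ∑_{j<s}) b` (the offset `∑_{i<σ_j} a - ∑_{j'<j} b` telescopes over
  consecutive common times and common steps contribute `0`).
* `exists_excursion_quadrants_SR` (registered anchor) — with the weights `dartWnd (·) F`: the polygon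
  of that excursion is a closed chain of unit steps with `dwnd = weight ≠ 0`, so by the quadrant lemma
  `closedChain_quadrants_SR` it has a vertex in each closed lattice quadrant at `F`; the vertices are
  listed as the coded source midpoints `cpos (O c (i + 1))` (= coded `cTgt (O c i)`) over the index
  ranges of the excursion.

References: S. Smirnov, Ann. of Math. 172 (2010), §4 (oriented medial lattice); H. Hopf, Compositio
Math. 2 (1935) (Umlaufsatz).
-/

namespace Summit.CriticalPhenomena.CardyFormulaZ2.Cruxes.EdgePrecompact.QkzStripBoundaryArm

open Literature.Probability.LatticeModels Literature.Probability.Percolation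
open Literature.Probability.LatticeModels.MedialTrail

/-! ## The winding pigeonhole over consecutive common times -/

/-- **Winding pigeonhole.** Two sequences `O₀` (injective on `[0, n₀]`) and `O₁` with `O₁ 0 = O₀ 0`,
`O₁ n₁ = O₀ n₀`, and weights with `∑_{i<n₀} a ≠ ∑_{j<n₁} b`: some pair of consecutive common times
`s < t ≤ n₁` (`O₁ s = O₀ σ`, `O₁ t = O₀ τ`, nothing common strictly between) has nonzero excursion
weight `(∑_{i<τ} a - ∑_{i<σ} a) - (∑_{j<t} b - ∑_{j<s} b)`. -/
theorem exists_excursion_of_sum_ne_SR {X : Type*} (O₀ O₁ : ℕ → X) (n₀ n₁ : ℕ) (a b : ℕ → ℤ)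
    (hinj₀ : ∀ i j : ℕ, i ≤ n₀ → j ≤ n₀ → O₀ i = O₀ j → i = j) (h0 : O₁ 0 = O₀ 0) (hend : O₁ n₁ = O₀ n₀)
    (hne : ∑ i ∈ Finset.range n₀, a i ≠ ∑ j ∈ Finset.range n₁, b j) :
    ∃ s t σ τ : ℕ, s < t ∧ t ≤ n₁ ∧ σ ≤ n₀ ∧ τ ≤ n₀ ∧ O₁ s = O₀ σ ∧ O₁ t = O₀ τ ∧
      (∀ j, s < j → j < t → ∀ i ≤ n₀, O₁ j ≠ O₀ i) ∧
      (∑ i ∈ Finset.range τ, a i - ∑ i ∈ Finset.range σ, a i) -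
        (∑ j ∈ Finset.range t, b j - ∑ j ∈ Finset.range s, b j) ≠ 0 := by
  classical
  set Cm : ℕ → Prop := fun j => ∃ i ≤ n₀, O₁ j = O₀ i with hCm
  have claim : ∀ j ≤ n₁, ∀ i ≤ n₀, O₁ j = O₀ i →
      (∃ s t σ τ : ℕ, s < t ∧ t ≤ j ∧ σ ≤ n₀ ∧ τ ≤ n₀ ∧ O₁ s = O₀ σ ∧ O₁ t = O₀ τ ∧
        (∀ j', s < j' → j' < t → ∀ i' ≤ n₀, O₁ j' ≠ O₀ i') ∧
        (∑ i' ∈ Finset.range τ, a i' - ∑ i' ∈ Finset.range σ, a i') -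
          (∑ j' ∈ Finset.range t, b j' - ∑ j' ∈ Finset.range s, b j') ≠ 0) ∨
      ∑ i' ∈ Finset.range i, a i' = ∑ j' ∈ Finset.range j, b j' := by
    intro j
    induction j using Nat.strong_induction_on with
    | _ j ih =>
      intro hj i hi hji
      rcases Nat.eq_zero_or_pos j with rfl | hjpos
      · right
        have : i = 0 := hinj₀ i 0 hi (Nat.zero_le _) (hji.symm.trans h0)
        subst this; simp
      · set s := Nat.findGreatest Cm (j - 1) with hs
        have hCs : Cm s := Nat.findGreatest_spec (P := Cm) (Nat.zero_le (j - 1)) ⟨0, Nat.zero_le _, h0⟩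
        have hsle : s ≤ j - 1 := Nat.findGreatest_le _
        have hfree : ∀ j', s < j' → j' < j → ¬ Cm j' := fun j' h1 h2 =>
          Nat.findGreatest_is_greatest h1 (by omega)
        obtain ⟨σ, hσ, hsσ⟩ := hCs
        rcases ih s (by omega) (by omega) σ hσ hsσ with hex | heq
        · left
          obtain ⟨s', t', σ', τ', h1, h2, rest⟩ := hex
          exact ⟨s', t', σ', τ', h1, by omega, rest⟩
        · by_cases hwz : (∑ i' ∈ Finset.range i, a i' - ∑ i' ∈ Finset.range σ, a i') -
              (∑ j' ∈ Finset.range j, b j' - ∑ j' ∈ Finset.range s, b j') = 0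
          · right; omega
          · left
            exact ⟨s, j, σ, i, by omega, le_rfl, hσ, hi, hsσ, hji,
              fun j' h1 h2 i' hi' heq' => hfree j' h1 h2 ⟨i', hi', heq'⟩, hwz⟩
  rcases claim n₁ le_rfl n₀ le_rfl hend with hex | heq
  · obtain ⟨s, t, σ, τ, h1, h2, rest⟩ := hex
    exact ⟨s, t, σ, τ, h1, h2, rest⟩
  · exact absurd heq hne

/-! ## Pieces of closed dart chains along a sequence of points -/

/-- Reversing a unit step negates its winding contribution. -/
theorem dartWnd_swap_SR {p q : Pt} (h : IsUnitStep p q) (F : Pt) : dartWnd (q, p) F = -dartWnd (p, q) F := by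
  obtain ⟨a, b⟩ := p
  obtain ⟨c, e⟩ := q
  simp only [IsUnitStep] at h
  simp only [dartWnd]
  rcases h with ⟨hc, he | he⟩ | ⟨he, hc | hc⟩ <;> subst hc <;> subst he <;> split_ifs <;> omega

/-- The forward piece `P m → P (m+1) → ⋯ → P (m+L)` as a dart list. -/
def fwdPiece (P : ℕ → Pt) (m L : ℕ) : List (Pt × Pt) := (List.range L).map fun k => (P (m + k), P (m + k + 1))

/-- The same piece traversed backwards (each step reversed). -/
def bwdPiece (P : ℕ → Pt) (m L : ℕ) : List (Pt × Pt) := (List.range L).map fun k => (P (m + k + 1), P (m + k))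

variable {P : ℕ → Pt} {m L : ℕ}

/-- Boundary of a forward piece. -/
theorem fwdPiece_boundary_SR (P : ℕ → Pt) (m L : ℕ) (g : Pt → ℤ) :
    ((fwdPiece P m L).map fun d => g d.2 - g d.1).sum = g (P (m + L)) - g (P m) := by
  rw [fwdPiece, List.map_map, ← List.sum_toFinset _ List.nodup_range, List.toFinset_range]
  have := Finset.sum_range_sub (fun k => g (P (m + k))) L
  simpa [Function.comp, add_assoc] using this

/-- Boundary of a backward piece. -/
theorem bwdPiece_boundary_SR (P : ℕ → Pt) (m L : ℕ) (g : Pt → ℤ) :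
    ((bwdPiece P m L).map fun d => g d.2 - g d.1).sum = g (P m) - g (P (m + L)) := by
  rw [bwdPiece, List.map_map, ← List.sum_toFinset _ List.nodup_range, List.toFinset_range]
  have := Finset.sum_range_sub' (fun k => g (P (m + k))) L
  simpa [Function.comp, add_assoc] using this

/-- Winding contribution of a forward piece. -/
theorem dwnd_fwdPiece_SR (P : ℕ → Pt) (m L : ℕ) (F : Pt) :
    dwnd (fwdPiece P m L) F = ∑ k ∈ Finset.range L, dartWnd (P (m + k), P (m + k + 1)) F := by
  rw [fwdPiece, dwnd, List.map_map, ← List.sum_toFinset _ List.nodup_range, List.toFinset_range]; rfl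

/-- Winding contribution of a backward piece of unit steps. -/
theorem dwnd_bwdPiece_SR (P : ℕ → Pt) (m L : ℕ) (F : Pt) (hP : ∀ k < L, IsUnitStep (P (m + k)) (P (m + k + 1))) :
    dwnd (bwdPiece P m L) F = -∑ k ∈ Finset.range L, dartWnd (P (m + k), P (m + k + 1)) F := by
  rw [bwdPiece, dwnd, List.map_map, ← Finset.sum_neg_distrib, ← List.sum_toFinset _ List.nodup_range, List.toFinset_range]
  refine Finset.sum_congr rfl fun k hk => ?_
  rw [Finset.mem_range] at hk
  exact dartWnd_swap_SR (hP k hk) F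

/-- Steps and tails of a forward piece. -/
theorem mem_fwdPiece_SR {d : Pt × Pt} (hd : d ∈ fwdPiece P m L) : ∃ k < L, d = (P (m + k), P (m + k + 1)) := by
  rw [fwdPiece, List.mem_map] at hd
  obtain ⟨k, hk, rfl⟩ := hd
  exact ⟨k, List.mem_range.1 hk, rfl⟩

/-- Steps and tails of a backward piece. -/
theorem mem_bwdPiece_SR {d : Pt × Pt} (hd : d ∈ bwdPiece P m L) : ∃ k < L, d = (P (m + k + 1), P (m + k)) := by
  rw [bwdPiece, List.mem_map] at hd
  obtain ⟨k, hk, rfl⟩ := hd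
  exact ⟨k, List.mem_range.1 hk, rfl⟩

/-- Splitting off an initial segment of a range sum: `∑_{i<m+L} f - ∑_{i<m} f = ∑_{k<L} f (m + k)`. -/
theorem sum_range_sub_sum_range_SR (f : ℕ → ℤ) (m L : ℕ) :
    ∑ i ∈ Finset.range (m + L), f i - ∑ i ∈ Finset.range m, f i = ∑ k ∈ Finset.range L, f (m + k) := by
  rw [Finset.sum_range_add]; ring

/-! ## The winding excursion polygon -/

/-- **A winding excursion polygon** (registered anchor). DATA: two orbit stretches `O₀ c [0, n₀]`,
`O₁ c [0, n₁]` (both injective) with `O₀ c n₀ = O₁ c n₁`, and a face `F` at which their coded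
winding contributions `∑_{i<n} dartWnd (cpos (O c i), cpos (O c (i+1))) F` differ. CONCLUSION: an
excursion `(s, t, σ, τ)` — consecutive common times `s < t ≤ n₁`, `O₁ c s = O₀ c σ`, `O₁ c t = O₀ c τ`,
`σ < n₀`, `1 ≤ τ ≤ n₀`, no corner `O₁ c j`, `s < j < t`, on the first stretch, not a common step —
whose polygon has a vertex in each of the four closed lattice quadrants at `F` (north-east
`{x ≥ F.1+1, y ≥ F.2+1}`, north-west, south-west, south-east), the vertices being the coded points
`cpos (O₁ c (j+1))`, `j ∈ [s, t)`, and `cpos (O₀ c (i+1))`, `i ∈ [σ, τ)` if `σ < τ`, resp.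
`i ∈ [τ-1, σ]` if `τ ≤ σ`. -/
theorem exists_excursion_quadrants_SR : ∀ (β₀ β₁ : BondConfig (Site 2)) (c : Site 2 × Fin 4) (n₀ n₁ : ℕ) (F : MedialTrail.Pt), (∀ i j : ℕ, i ≤ n₀ → j ≤ n₀ → cornerOrbit β₀ c i = cornerOrbit β₀ c j → i = j) → (∀ i j : ℕ, i ≤ n₁ → j ≤ n₁ → cornerOrbit β₁ c i = cornerOrbit β₁ c j → i = j) → cornerOrbit β₀ c n₀ = cornerOrbit β₁ c n₁ → ∑ i ∈ Finset.range n₀, MedialTrail.dartWnd (cpos (cornerOrbit β₀ c i), cpos (cornerOrbit β₀ c (i + 1))) F ≠ ∑ j ∈ Finset.range n₁, MedialTrail.dartWnd (cpos (cornerOrbit β₁ c j), cpos (cornerOrbit β₁ c (j + 1))) F → ∃ s t σ τ : ℕ, s < t ∧ t ≤ n₁ ∧ σ < n₀ ∧ 1 ≤ τ ∧ τ ≤ n₀ ∧ cornerOrbit β₁ c s = cornerOrbit β₀ c σ ∧ cornerOrbit β₁ c t = cornerOrbit β₀ c τ ∧ (∀ j, s < j → j < t → ∀ i ≤ n₀,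 cornerOrbit β₁ c j ≠ cornerOrbit β₀ c i) ∧ ¬ (t = s + 1 ∧ τ = σ + 1) ∧ (∃ p ∈ ((fun j => cpos (cornerOrbit β₁ c (j + 1))) '' Set.Ico s t ∪ (fun i => cpos (cornerOrbit β₀ c (i + 1))) '' (if σ < τ then Set.Ico σ τ else Set.Ico (τ - 1) (σ + 1))), F.1 + 1 ≤ p.1 ∧ F.2 + 1 ≤ p.2) ∧ (∃ p ∈ ((fun j => cpos (cornerOrbit β₁ c (j + 1))) '' Set.Ico s t ∪ (fun i => cpos (cornerOrbit β₀ c (i + 1))) '' (if σ < τ then Set.Ico σ τ else Set.Ico (τ - 1) (σ + 1))), p.1 ≤ F.1 ∧ F.2 + 1 ≤ p.2) ∧ (∃ p ∈ ((fun j => cpos (cornerOrbit β₁ c (j + 1))) '' Set.Ico s t ∪ (fun i => cpos (cornerOrbit β₀ c (i + 1))) '' (if σ < τ then Set.Ico σ τ else Set.Ico (τ - 1) (σ + 1))), p.1 ≤ F.1 ∧ p.2 ≤ F.2) ∧ (∃ p ∈ ((fun j => cpos (cornerOrbit β₁ c (j + 1))) '' Set.Ico s t ∪ (fun i => cpos (cornerOrbit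 β₀ c (i + 1))) '' (if σ < τ then Set.Ico σ τ else Set.Ico (τ - 1) (σ + 1))), F.1 + 1 ≤ p.1 ∧ p.2 ≤ F.2) := by
  intro β₀ β₁ c n₀ n₁ F hinj₀ hinj₁ hend hne
  set P₀ : ℕ → Pt := fun i => cpos (cornerOrbit β₀ c i) with hP₀
  set P₁ : ℕ → Pt := fun j => cpos (cornerOrbit β₁ c j) with hP₁
  set a : ℕ → ℤ := fun i => dartWnd (P₀ i, P₀ (i + 1)) F with ha
  set b : ℕ → ℤ := fun j => dartWnd (P₁ j, P₁ (j + 1)) F with hb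
  -- common corners have equal coded darts, hence equal weights
  have hcom : ∀ i j, cornerOrbit β₁ c j = cornerOrbit β₀ c i → P₁ j = P₀ i ∧ P₁ (j + 1) = P₀ (i + 1) := by
    intro i j h
    refine ⟨congrArg cpos h, ?_⟩
    change cpos (nextCorner β₁ (cornerOrbit β₁ c j)) = cpos (nextCorner β₀ (cornerOrbit β₀ c i))
    rw [cpos_nextCorner, cpos_nextCorner, h]
  obtain ⟨s, t, σ, τ, hst, htn, hσ, hτ, hs, ht, hfree, hw⟩ :=
    exists_excursion_of_sum_ne_SR (cornerOrbit β₀ c) (cornerOrbit β₁ c) n₀ n₁ a b hinj₀ rfl hend.symm hne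
  -- index facts
  have hσn : σ < n₀ := by
    refine lt_of_le_of_ne hσ fun h => ?_
    subst h
    have := hinj₁ s n₁ (by omega) le_rfl (hs.trans hend); omega
  have hτ1 : 1 ≤ τ := by
    rcases Nat.eq_zero_or_pos τ with rfl | h
    · have := hinj₁ t 0 htn (Nat.zero_le _) ht; omega
    · exact h
  have hab : b s = a σ := by
    simp only [ha, hb]; rw [(hcom σ s hs).1, (hcom σ s hs).2]
  have hntriv : ¬ (t = s + 1 ∧ τ = σ + 1) := by
    rintro ⟨rfl, rfl⟩
    apply hw
    rw [Finset.sum_range_succ, Finset.sum_range_succ, hab]; ring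
  refine ⟨s, t, σ, τ, hst, htn, hσn, hτ1, hτ, hs, ht, hfree, hntriv, ?_⟩
  -- unit steps along both stretches
  have hu₀ : ∀ i, IsUnitStep (P₀ i) (P₀ (i + 1)) := fun i => (isDart_cpos β₀ (cornerOrbit β₀ c i)).isUnitStep
  have hu₁ : ∀ j, IsUnitStep (P₁ j) (P₁ (j + 1)) := fun j => (isDart_cpos β₁ (cornerOrbit β₁ c j)).isUnitStep
  -- the excursion polygon `E`, by cases on the direction along the first stretch
  by_cases hστ : σ < τ
  · -- downstream: forward darts `σ+1 … τ` of the first stretch, free darts `s+1 … t` reversed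
    set E : List (Pt × Pt) := fwdPiece P₀ (σ + 1) (τ - σ - 1) ++ bwdPiece P₁ (s + 1) (t - s - 1) with hE
    have hEu : ∀ d ∈ E, IsUnitStep d.1 d.2 ∨ d.1 = d.2 := by
      intro d hd
      rw [hE, List.mem_append] at hd
      rcases hd with hd | hd
      · obtain ⟨k, hk, rfl⟩ := mem_fwdPiece_SR hd; exact Or.inl (hu₀ _)
      · obtain ⟨k, hk, rfl⟩ := mem_bwdPiece_SR hd; exact Or.inl (hu₁ _).symm
    have hEK : ∀ g : Pt → ℤ, (E.map fun d => g d.2 - g d.1).sum = 0 := by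
      intro g
      rw [hE, List.map_append, List.sum_append, fwdPiece_boundary_SR, bwdPiece_boundary_SR,
        show σ + 1 + (τ - σ - 1) = τ by omega, show s + 1 + (t - s - 1) = t by omega,
        (hcom σ s hs).2, (hcom τ t ht).1]
      ring
    have hEw : dwnd E F ≠ 0 := by
      rw [hE, dwnd_append, dwnd_fwdPiece_SR, dwnd_bwdPiece_SR _ _ _ _ (fun k _ => hu₁ _)]
      intro h0
      apply hw
      have e1 := sum_range_sub_sum_range_SR a σ (τ - σ - 1 + 1)
      rw [show σ + (τ - σ - 1 + 1) = τ by omega, Finset.sum_range_succ', add_zero] at e1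
      have e2 := sum_range_sub_sum_range_SR b s (t - s - 1 + 1)
      rw [show s + (t - s - 1 + 1) = t by omega, Finset.sum_range_succ', add_zero] at e2
      have e3 : ∑ k ∈ Finset.range (τ - σ - 1), a (σ + (k + 1)) =
          ∑ k ∈ Finset.range (τ - σ - 1), dartWnd (P₀ (σ + 1 + k), P₀ (σ + 1 + k + 1)) F :=
        Finset.sum_congr rfl fun k _ => by simp only [ha]; congr 3 <;> ring
      have e4 : ∑ k ∈ Finset.range (t - s - 1), b (s + (k + 1)) =
          ∑ k ∈ Finset.range (t - s - 1), dartWnd (P₁ (s + 1 + k), P₁ (s + 1 + k + 1)) F :=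
        Finset.sum_congr rfl fun k _ => by simp only [hb]; congr 3 <;> ring
      linarith
    have htails : ∀ d ∈ E, d.1 ∈ ((fun j => cpos (cornerOrbit β₁ c (j + 1))) '' Set.Ico s t ∪
        (fun i => cpos (cornerOrbit β₀ c (i + 1))) '' (if σ < τ then Set.Ico σ τ else Set.Ico (τ - 1) (σ + 1))) := by
      intro d hd
      rw [if_pos hστ]
      rw [hE, List.mem_append] at hd
      rcases hd with hd | hd
      · obtain ⟨k, hk, rfl⟩ := mem_fwdPiece_SR hd
        refine Or.inr ⟨σ + k, ⟨by omega, by omega⟩, ?_⟩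
        simp only [hP₀]; congr 2; ring
      · obtain ⟨k, hk, rfl⟩ := mem_bwdPiece_SR hd
        refine Or.inl ⟨s + 1 + k, ⟨by omega, by omega⟩, ?_⟩
        simp only [hP₁]
    obtain ⟨⟨d₁, hd₁, q₁⟩, ⟨d₂, hd₂, q₂⟩, ⟨d₃, hd₃, q₃⟩, ⟨d₄, hd₄, q₄⟩⟩ :=
      closedChain_quadrants_SR E F hEu hEK hEw
    exact ⟨⟨d₁.1, htails d₁ hd₁, q₁⟩, ⟨d₂.1, htails d₂ hd₂, q₂⟩, ⟨d₃.1, htails d₃ hd₃, q₃⟩, ⟨d₄.1, htails d₄ hd₄, q₄⟩⟩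
  · -- upstream: darts `τ … σ` of the first stretch reversed, darts `s … t` of the second reversed
    push Not at hστ
    set E : List (Pt × Pt) := bwdPiece P₀ τ (σ - τ) ++ bwdPiece P₁ s (t - s) with hE
    have hEu : ∀ d ∈ E, IsUnitStep d.1 d.2 ∨ d.1 = d.2 := by
      intro d hd
      rw [hE, List.mem_append] at hd
      rcases hd with hd | hd
      · obtain ⟨k, hk, rfl⟩ := mem_bwdPiece_SR hd; exact Or.inl (hu₀ _).symm
      · obtain ⟨k, hk, rfl⟩ := mem_bwdPiece_SR hd; exact Or.inl (hu₁ _).symm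
    have hEK : ∀ g : Pt → ℤ, (E.map fun d => g d.2 - g d.1).sum = 0 := by
      intro g
      rw [hE, List.map_append, List.sum_append, bwdPiece_boundary_SR, bwdPiece_boundary_SR,
        show τ + (σ - τ) = σ by omega, show s + (t - s) = t by omega, (hcom σ s hs).1, (hcom τ t ht).1]
      ring
    have hEw : dwnd E F ≠ 0 := by
      rw [hE, dwnd_append, dwnd_bwdPiece_SR _ _ _ _ (fun k _ => hu₀ _), dwnd_bwdPiece_SR _ _ _ _ (fun k _ => hu₁ _)]
      intro h0
      apply hw
      have e1 := sum_range_sub_sum_range_SR a τ (σ - τ)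
      rw [show τ + (σ - τ) = σ by omega] at e1
      have e2 := sum_range_sub_sum_range_SR b s (t - s)
      rw [show s + (t - s) = t by omega] at e2
      have e3 : ∑ k ∈ Finset.range (σ - τ), a (τ + k) = ∑ k ∈ Finset.range (σ - τ), dartWnd (P₀ (τ + k), P₀ (τ + k + 1)) F := rfl
      have e4 : ∑ k ∈ Finset.range (t - s), b (s + k) = ∑ k ∈ Finset.range (t - s), dartWnd (P₁ (s + k), P₁ (s + k + 1)) F := rfl
      linarith
    have htails : ∀ d ∈ E, d.1 ∈ ((fun j => cpos (cornerOrbit β₁ c (j + 1))) '' Set.Ico s t ∪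
        (fun i => cpos (cornerOrbit β₀ c (i + 1))) '' (if σ < τ then Set.Ico σ τ else Set.Ico (τ - 1) (σ + 1))) := by
      intro d hd
      rw [if_neg (not_lt.2 hστ)]
      rw [hE, List.mem_append] at hd
      rcases hd with hd | hd
      · obtain ⟨k, hk, rfl⟩ := mem_bwdPiece_SR hd
        refine Or.inr ⟨τ + k, ⟨by omega, by omega⟩, ?_⟩
        simp only [hP₀]
      · obtain ⟨k, hk, rfl⟩ := mem_bwdPiece_SR hd
        refine Or.inl ⟨s + k, ⟨by omega, by omega⟩, ?_⟩
        simp only [hP₁]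
    obtain ⟨⟨d₁, hd₁, q₁⟩, ⟨d₂, hd₂, q₂⟩, ⟨d₃, hd₃, q₃⟩, ⟨d₄, hd₄, q₄⟩⟩ :=
      closedChain_quadrants_SR E F hEu hEK hEw
    exact ⟨⟨d₁.1, htails d₁ hd₁, q₁⟩, ⟨d₂.1, htails d₂ hd₂, q₂⟩, ⟨d₃.1, htails d₃ hd₃, q₃⟩, ⟨d₄.1, htails d₄ hd₄, q₄⟩⟩

end Summit.CriticalPhenomena.CardyFormulaZ2.Cruxes.EdgePrecompact.QkzStripBoundaryArm
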